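import Summits.CriticalPhenomena.PercolationContinuityZ3.Theorems.PercNearOneGluingNoHeavyLowerTailStarSetOmegaStar
import Summits.CriticalPhenomena.PercolationContinuityZ3.Theorems.PercNearOneGluingNoHeavyLowerTailStarSetSwapAdmissible
import HarnessLib

/-!
# `NoHeavyLowerTail` (stmt-CriticalPhenomena-4575) — STAR units are swap-admissible (U1-PROOF.md L4.1 + L5.4(a); blueprint §G4)

Support file (prover `prim-gen-swap` gen 15; `--supports stmt-CriticalPhenomena-4575`).  No definitions, no named facts, no sorries.

First step of the RESIDUAL structure theorem of the U1′_r charging scheme (LEAN-BLUEPRINT-U1.md §G4): a charged unit `(S, X)` with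
`y(S) = 1` is never residual.  Indeed `S` then has a second Ω-chord `X'` (the free one), so by `omega_star_of_no_triangle` (no r-free
triangle in `S`) every class of `S` passes through one port `v ≠ r` of `X = {v, a}`; non-regularity of the pair `(X, X')` makes the far
end `a` hot, and the dominator `{a, r}` is a child edge `A` (it is not the leaf class `I₀ = {q₀, r}`: the free rule keeps the spoke through
`q₀` free); then `A ∉ S`, the class `X'` avoids `a`, the swapped configuration `S − X + A` has no Ω-chord (a chord `μ ≠ X` of `S` through
`a` would be `{v, a} = X`) and its first open forest class is a child edge (`A`, or the one of `S`).  So the swap at `a` is admissible.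

* `StarSet.star_unit_admissible` — the admissibility data `(d, P (dom X d) = r, a class avoiding d, Ω(target) = ∅, y(target) = 1)`.
-/

namespace Summit.CriticalPhenomena.PercolationContinuityZ3.Theorems

open Finset
open scoped BigOperators

namespace StarSet

variable {ι V : Type*} [LinearOrder ι] [DecidableEq V]

/-- **STAR units are swap-admissible (U1-PROOF.md L5.4(a)).**  See the file header.  `X'` is the free Ω-chord of `S` (a second chord of
`S` avoiding `r` adjacent to every class of `S`, passing through `q₀ = P I₀` whenever `X` does); `hNR` is non-regularity of `X` against
`X'` at the far end; `hy` is `y(S) = 1`. -/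
theorem star_unit_admissible (P P' : ι → V) (hPP' : ∀ X, P X ≠ P' X)
    (hinj : Function.Injective fun X => (s(P X, P' X) : Sym2 V)) (r : V) (F : Finset ι)
    (dom : ι → V → ι)
    (hdom : ∀ X ∉ F, ∀ d, (P X = d ∨ P' X = d) → dom X d ∈ F ∧ (P (dom X d) = d ∨ P' (dom X d) = d))
    (S : Finset ι) {X X' : ι} (hXS : X ∈ S) (hXF : X ∉ F) (hXr : P X ≠ r ∧ P' X ≠ r)
    (hXadj : ∀ Y ∈ S, P Y = P X ∨ P Y = P' X ∨ P' Y = P X ∨ P' Y = P' X)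
    (hX'S : X' ∈ S) (hX'X : X' ≠ X) (hX'r : P X' ≠ r ∧ P' X' ≠ r)
    (hX'adj : ∀ Y ∈ S, P Y = P X' ∨ P Y = P' X' ∨ P' Y = P X' ∨ P' Y = P' X')
    (hq₀ : ∀ I ∈ F, P' I = r → (P X = P I ∨ P' X = P I) → (P X' = P I ∨ P' X' = P I))
    (hnotri : ¬ ∃ a b c : V, a ≠ b ∧ a ≠ c ∧ b ≠ c ∧ a ≠ r ∧ b ≠ r ∧ c ≠ r ∧
      (∃ X ∈ S, (s(P X, P' X) : Sym2 V) = s(a, b)) ∧ (∃ Y ∈ S, (s(P Y, P' Y) : Sym2 V) = s(a, c)) ∧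
        ∃ Z ∈ S, (s(P Z, P' Z) : Sym2 V) = s(b, c))
    (hy : (∀ I ∈ F, I ∉ S) ∨ ∃ a ∈ F, P a = r ∧ a ∈ S ∧ ∀ b ∈ F, b < a → b ∉ S)
    (hNR : ∀ p, (P X = p ∨ P' X = p) → (P X' ≠ p ∧ P' X' ≠ p) → (P (dom X p) = r ∨ P' (dom X p) = r)) :
    ∃ d, (P X = d ∨ P' X = d) ∧ P (dom X d) = r ∧ (∃ Y ∈ S, P Y ≠ d ∧ P' Y ≠ d) ∧
      (∀ μ ∈ insert (dom X d) (S.erase X), μ ∉ F → (P μ ≠ r ∧ P' μ ≠ r) →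
        ∃ j ∈ insert (dom X d) (S.erase X), ¬ (P j = P μ ∨ P j = P' μ ∨ P' j = P μ ∨ P' j = P' μ)) ∧
      ((∀ I ∈ F, I ∉ insert (dom X d) (S.erase X)) ∨
        ∃ a ∈ F, P a = r ∧ a ∈ insert (dom X d) (S.erase X) ∧ ∀ b ∈ F, b < a → b ∉ insert (dom X d) (S.erase X)) := by
  classical
  -- the star centre `v`
  obtain ⟨v, hvr, hvΩ, hvS⟩ := omega_star_of_no_triangle P P' hPP' hinj r S {X, X'}
    (by
      intro K hK
      rcases mem_insert.1 hK with rfl | hK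
      · exact hXS
      · rw [mem_singleton.1 hK]; exact hX'S)
    (by rw [card_pair hX'X.symm])
    (by
      intro K hK
      rcases mem_insert.1 hK with rfl | hK
      · exact hXr
      · rw [mem_singleton.1 hK]; exact hX'r)
    (by
      intro K hK Y hY
      rcases mem_insert.1 hK with rfl | hK
      · rcases hXadj Y hY with h | h | h | h
        · exact Or.inl h.symm
        · exact Or.inr (Or.inr (Or.inl h.symm))
        · exact Or.inr (Or.inl h.symm)
        · exact Or.inr (Or.inr (Or.inr h.symm))
      · rw [mem_singleton.1 hK]
        rcases hX'adj Y hY with h | h | h | h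
        · exact Or.inl h.symm
        · exact Or.inr (Or.inr (Or.inl h.symm))
        · exact Or.inr (Or.inl h.symm)
        · exact Or.inr (Or.inr (Or.inr h.symm)))
    hnotri
  have hvX : P X = v ∨ P' X = v := hvΩ X (mem_insert_self _ _)
  have hvX' : P X' = v ∨ P' X' = v := hvΩ X' (mem_insert_of_mem (mem_singleton_self _))
  -- the far end `a` of `X`
  obtain ⟨a, haX, hav, hXva⟩ : ∃ a, (P X = a ∨ P' X = a) ∧ a ≠ v ∧
      ((P X = v ∧ P' X = a) ∨ (P X = a ∧ P' X = v)) := by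
    rcases hvX with h | h
    · exact ⟨P' X, Or.inr rfl, fun h' => hPP' X (h.trans h'.symm), Or.inl ⟨h, rfl⟩⟩
    · exact ⟨P X, Or.inl rfl, fun h' => hPP' X (h'.trans h.symm), Or.inr ⟨rfl, h⟩⟩
  have har : a ≠ r := by
    rcases haX with h | h
    · rw [← h]; exact hXr.1
    · rw [← h]; exact hXr.2
  -- `a ∉ X'` (else `X' = X`)
  have haX' : P X' ≠ a ∧ P' X' ≠ a := by
    have key : ¬ (P X' = a ∨ P' X' = a) := by
      intro h
      apply hX'X
      apply hinj
      simp only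
      rcases hvX' with h1 | h1 <;> rcases h with h2 | h2
      · exact absurd (h1.symm.trans h2) hav.symm
      · rcases hXva with ⟨h3, h4⟩ | ⟨h3, h4⟩
        · rw [h1, h2, h3, h4]
        · rw [h1, h2, h3, h4]; exact Sym2.eq_swap
      · rcases hXva with ⟨h3, h4⟩ | ⟨h3, h4⟩
        · rw [h1, h2, h3, h4]; exact Sym2.eq_swap
        · rw [h1, h2, h3, h4]
      · exact absurd (h1.symm.trans h2) hav.symm
    exact ⟨fun h => key (Or.inl h), fun h => key (Or.inr h)⟩
  -- `a` is hot, and the dominator `A = dom X a` is the child edge `{a, r}`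
  obtain ⟨hAF, hAa⟩ := hdom X hXF a haX
  have hAr : P (dom X a) = r ∨ P' (dom X a) = r := hNR a haX haX'
  have hA : P (dom X a) = r ∧ P' (dom X a) = a := by
    rcases hAr with h | h
    · refine ⟨h, hAa.resolve_left fun h' => har (h'.symm.trans h)⟩
    · -- `A` would be the leaf class `I₀`, `a = q₀`, and the free rule would put `X'` through `a`
      exfalso
      have hPa : P (dom X a) = a := hAa.resolve_right fun h' => har (h'.symm.trans h)
      have := hq₀ (dom X a) hAF h (by rw [hPa]; exact haX)
      rw [hPa] at this
      rcases this with h' | h'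
      · exact haX'.1 h'
      · exact haX'.2 h'
  set A := dom X a with hAdef
  -- `A ∉ S`: every class of `S` contains `v ∉ {a, r}`
  have hAS : A ∉ S := by
    intro h
    rcases hvS A h with h' | h'
    · exact hvr (h'.symm.trans hA.1)
    · exact hav.symm (h'.symm.trans hA.2)
  have hAX : A ≠ X := fun h => hXF (h ▸ hAF)
  refine ⟨a, haX, hA.1, ⟨X', hX'S, haX'⟩, ?_, ?_⟩
  · -- no Ω-chord in the target: `A` is far from every chord `μ ≠ X` of `S` avoiding `r` (such `μ` contains `v`, not `a`)
    intro μ hμ hμF hμr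
    refine ⟨A, mem_insert_self _ _, ?_⟩
    have hμA : μ ≠ A := fun h => hμF (h ▸ hAF)
    have hμS : μ ∈ S := mem_of_mem_erase ((mem_insert.1 hμ).resolve_left hμA)
    have hμX : μ ≠ X := ne_of_mem_erase ((mem_insert.1 hμ).resolve_left hμA)
    have hμa : ¬ (P μ = a ∨ P' μ = a) := by
      intro h
      apply hμX
      apply hinj
      simp only
      rcases hvS μ hμS with h1 | h1 <;> rcases h with h2 | h2
      · exact absurd (h1.symm.trans h2) hav.symm
      · rcases hXva with ⟨h3, h4⟩ | ⟨h3, h4⟩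
        · rw [h1, h2, h3, h4]
        · rw [h1, h2, h3, h4]; exact Sym2.eq_swap
      · rcases hXva with ⟨h3, h4⟩ | ⟨h3, h4⟩
        · rw [h1, h2, h3, h4]; exact Sym2.eq_swap
        · rw [h1, h2, h3, h4]
      · exact absurd (h1.symm.trans h2) hav.symm
    exact chord_far_of_not_mem P P' r a A μ (Or.inr hA) hμr hμa
  · -- the first open forest class of the target is a child edge
    right
    rcases hy with hy0 | ⟨a₀, ha₀F, ha₀r, ha₀S, ha₀min⟩
    · refine ⟨A, hAF, hA.1, mem_insert_self _ _, fun b hbF hbA hb => ?_⟩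
      rcases mem_insert.1 hb with hb | hb
      · exact absurd hb (ne_of_lt hbA)
      · exact hy0 b hbF (mem_of_mem_erase hb)
    · have ha₀A : a₀ ≠ A := fun h => hAS (h ▸ ha₀S)
      have ha₀X : a₀ ≠ X := fun h => hXF (h ▸ ha₀F)
      rcases lt_or_gt_of_ne ha₀A with hlt | hlt
      · refine ⟨a₀, ha₀F, ha₀r, mem_insert_of_mem (mem_erase.2 ⟨ha₀X, ha₀S⟩), fun b hbF hba hb => ?_⟩
        rcases mem_insert.1 hb with hb | hb
        · rw [hb] at hba; exact absurd hba (lt_asymm hlt)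
        · exact ha₀min b hbF hba (mem_of_mem_erase hb)
      · refine ⟨A, hAF, hA.1, mem_insert_self _ _, fun b hbF hbA hb => ?_⟩
        rcases mem_insert.1 hb with hb | hb
        · exact absurd hb (ne_of_lt hbA)
        · exact ha₀min b hbF (hbA.trans hlt) (mem_of_mem_erase hb)

end StarSet

end Summit.CriticalPhenomena.PercolationContinuityZ3.Theorems
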